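import Literature.NumberTheory.LFunctions.TruncatedWeilFormVolterraKernelRigidity
import HarnessLib

/-!
# RH-FREE — «nothing here bears on the truth of RH»: the Volterra integral-domain step of Groskin's Corollary 2.7 (arXiv:2607.02828) — cross terms and partial fractions

PROOF LAYER (theorems only, 0 defs, 0 named facts), STAGE V part 2 of the discharge of the claim
`Groskin2026.corollary_2_7` (statement file `TruncatedWeilFormFiniteDictionary.lean`, rh-lit-frontier-1).
Source: A. Groskin, arXiv:2607.02828v3, proof of Corollary 2.7, p. 8: "`K_v = 2(T_v ∗ T_v)` in the Volterra
convolution algebra of analytic germs at `0`. This algebra is an integral domain … then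
`(T_v − T_w) ∗ (T_v + T_w) = 0`, so `T_v = ±T_w` and `v = ±w`." Written by seat rh-crit-cc-t4 g5.

Route (an elementary rendering of the integral-domain argument; the Volterra product of the exponentials
`e^{2πimt}` is encoded by the rational function `R_u(s) = Σ_m u_m/(s − m)`, whose square has double-pole
coefficients `u_m²` and simple-pole coefficients `2 Σ_{n≠m} u_m u_n/(m − n)`):

* `sum_cross_mul_offDiag_eq_zero`, `sum_cross_eq_sin_sum` — with `u_m² = u′_m²` known
  (`sq_evenEmbed_eq_of_volterraKernel_eqOn`), `K_v = K_w` on `ℝ` reduces to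
  `Σ_m D_m sin(2πωm) = 0`, `D_m = Σ_{n≠m} (u_mu_n − u′_mu′_n)/(m − n)`;
* `eq_zero_of_sum_mul_sin_eq_zero` — uniqueness of odd sine sums; `D` is odd; hence `D = 0`;
* `evenEmbed_eq_or_eq_neg` — **the partial-fraction step**: `u_m² = u′_m²` and `D = 0` give, for every
  real `s` off the nodes, `(Σ_m (u_m − u′_m)/(s − m)) · (Σ_m (u_m + u′_m)/(s − m)) = 0`; clearing
  denominators, a product of two polynomials vanishes at infinitely many points, so one of them is `0`
  (`ℝ[X]` is a domain), and evaluating at the nodes gives `u = u′` or `u = −u′`;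
* `eq_or_eq_neg_of_volterraKernel_eqOn` — `K_v = K_w` on `[0,1]` ⇒ `v = w ∨ v = −w`;
  `corollary_2_7_holds` — the claim, via `corollary_2_7_of_volterra`.

The source is an unrefereed preprint (`[claim: Groskin2026, status: under-review]`); a kernel proof of
these finite identities asserts nothing on its authority. Nothing here bears on Weil positivity or on the
truth of RH.
-/

noncomputable section

open Filter Set MeasureTheory Complex Finset Matrix
open scoped Real Topology

namespace Literature.NumberTheory.LFunctions

namespace Groskin2026

/-! ### The cross terms -/

/-- With `u_m² = u′_m²`, the identity `K_v = K_w` (real closed forms) says that the off-diagonal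
("cross") terms agree: `Σ_{m≠n} (u_mu_n − u′_mu′_n)(sin 2πωm − sin 2πωn)/(π(m−n)) = 0`.
[cite: Groskin2026, Corollary 2.7, proof (p. 8)] -/
theorem sum_cross_mul_offDiag_eq_zero (N : ℕ) (v w : Fin (N + 1) → ℝ)
    (hall : volterraKernel N v = volterraKernel N w)
    (hsq : ∀ m : idx N, evenEmbed N v m ^ 2 = evenEmbed N w m ^ 2) (ω : ℝ) :
    ∑ m : idx N, ∑ n : idx N,
      (evenEmbed N v m * evenEmbed N v n - evenEmbed N w m * evenEmbed N w n) *
        (if ((m : ℤ)) = (n : ℤ) then (0 : ℝ)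
          else (1 / π * Real.sin (2 * π * ω * ((m : ℤ) : ℝ)) -
              1 / π * Real.sin (2 * π * ω * ((n : ℤ) : ℝ))) / (((m : ℤ) : ℝ) - ((n : ℤ) : ℝ))) = 0 := by
  have hv := volterraKernel_eq_sum N v ω
  have hw := volterraKernel_eq_sum N w ω
  rw [hall] at hv
  rw [hv] at hw
  have hre : ∑ m : idx N, evenEmbed N v m * ∑ n : idx N,
        (if ((m : ℤ)) = (n : ℤ) then 2 * ω * Real.cos (2 * π * ω * ((m : ℤ) : ℝ))
          else (1 / π * Real.sin (2 * π * ω * ((m : ℤ) : ℝ)) -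
              1 / π * Real.sin (2 * π * ω * ((n : ℤ) : ℝ))) / (((m : ℤ) : ℝ) - ((n : ℤ) : ℝ))) *
          evenEmbed N v n =
      ∑ m : idx N, evenEmbed N w m * ∑ n : idx N,
        (if ((m : ℤ)) = (n : ℤ) then 2 * ω * Real.cos (2 * π * ω * ((m : ℤ) : ℝ))
          else (1 / π * Real.sin (2 * π * ω * ((m : ℤ) : ℝ)) -
              1 / π * Real.sin (2 * π * ω * ((n : ℤ) : ℝ))) / (((m : ℤ) : ℝ) - ((n : ℤ) : ℝ))) *
          evenEmbed N w n := by
    exact_mod_cast hw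
  -- difference of the two double sums, term by term
  have hdiff : ∑ m : idx N, ∑ n : idx N,
      (evenEmbed N v m * evenEmbed N v n - evenEmbed N w m * evenEmbed N w n) *
        (if ((m : ℤ)) = (n : ℤ) then 2 * ω * Real.cos (2 * π * ω * ((m : ℤ) : ℝ))
          else (1 / π * Real.sin (2 * π * ω * ((m : ℤ) : ℝ)) -
              1 / π * Real.sin (2 * π * ω * ((n : ℤ) : ℝ))) / (((m : ℤ) : ℝ) - ((n : ℤ) : ℝ))) = 0 := by
    have h1 : ∀ u : idx N → ℝ, ∑ m : idx N, u m * ∑ n : idx N,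
        (if ((m : ℤ)) = (n : ℤ) then 2 * ω * Real.cos (2 * π * ω * ((m : ℤ) : ℝ))
          else (1 / π * Real.sin (2 * π * ω * ((m : ℤ) : ℝ)) -
              1 / π * Real.sin (2 * π * ω * ((n : ℤ) : ℝ))) / (((m : ℤ) : ℝ) - ((n : ℤ) : ℝ))) * u n =
        ∑ m : idx N, ∑ n : idx N, (u m * u n) *
          (if ((m : ℤ)) = (n : ℤ) then 2 * ω * Real.cos (2 * π * ω * ((m : ℤ) : ℝ))
            else (1 / π * Real.sin (2 * π * ω * ((m : ℤ) : ℝ)) -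
                1 / π * Real.sin (2 * π * ω * ((n : ℤ) : ℝ))) / (((m : ℤ) : ℝ) - ((n : ℤ) : ℝ))) := by
      intro u
      refine Finset.sum_congr rfl fun m _ ↦ ?_
      rw [Finset.mul_sum]
      refine Finset.sum_congr rfl fun n _ ↦ ?_
      ring
    rw [h1, h1] at hre
    rw [← sub_eq_zero, ← Finset.sum_sub_distrib] at hre
    rw [← hre]
    refine Finset.sum_congr rfl fun m _ ↦ ?_
    rw [← Finset.sum_sub_distrib]
    refine Finset.sum_congr rfl fun n _ ↦ ?_
    ring
  rw [← hdiff]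
  refine Finset.sum_congr rfl fun m _ ↦ Finset.sum_congr rfl fun n _ ↦ ?_
  by_cases hmn : ((m : ℤ)) = (n : ℤ)
  · have hmn' : m = n := Subtype.ext hmn
    subst hmn'
    have : evenEmbed N v m * evenEmbed N v m - evenEmbed N w m * evenEmbed N w m = 0 := by
      rw [← pow_two, ← pow_two, hsq m, sub_self]
    rw [this, zero_mul, zero_mul]
  · rw [if_neg hmn, if_neg hmn]

/-- **Regrouping the cross terms**: the off-diagonal double sum equals `(2/π) Σ_m D_m sin(2πωm)` with
`D_m = Σ_{n≠m} (u_mu_n − u′_mu′_n)/(m − n)` (swap `m ↔ n` in the second half).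
[cite: Groskin2026, Corollary 2.7, proof (p. 8)] -/
theorem sum_cross_eq_sin_sum (N : ℕ) (v w : Fin (N + 1) → ℝ) (ω : ℝ) :
    ∑ m : idx N, ∑ n : idx N,
      (evenEmbed N v m * evenEmbed N v n - evenEmbed N w m * evenEmbed N w n) *
        (if ((m : ℤ)) = (n : ℤ) then (0 : ℝ)
          else (1 / π * Real.sin (2 * π * ω * ((m : ℤ) : ℝ)) -
              1 / π * Real.sin (2 * π * ω * ((n : ℤ) : ℝ))) / (((m : ℤ) : ℝ) - ((n : ℤ) : ℝ))) =
      2 / π * ∑ m : idx N, (∑ n : idx N, (if ((m : ℤ)) = (n : ℤ) then (0 : ℝ)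
          else (evenEmbed N v m * evenEmbed N v n - evenEmbed N w m * evenEmbed N w n) /
            (((m : ℤ) : ℝ) - ((n : ℤ) : ℝ)))) * Real.sin (2 * π * ω * ((m : ℤ) : ℝ)) := by
  -- `P m n` and `Q m n`: the two halves of each term
  set x : idx N → idx N → ℝ := fun m n ↦
    evenEmbed N v m * evenEmbed N v n - evenEmbed N w m * evenEmbed N w n with hx
  set P : idx N → idx N → ℝ := fun m n ↦ if ((m : ℤ)) = (n : ℤ) then (0 : ℝ)
    else x m n / (((m : ℤ) : ℝ) - ((n : ℤ) : ℝ)) * (1 / π * Real.sin (2 * π * ω * ((m : ℤ) : ℝ)))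
    with hP
  set Q : idx N → idx N → ℝ := fun m n ↦ if ((m : ℤ)) = (n : ℤ) then (0 : ℝ)
    else x m n / (((m : ℤ) : ℝ) - ((n : ℤ) : ℝ)) * (1 / π * Real.sin (2 * π * ω * ((n : ℤ) : ℝ)))
    with hQ
  have hxsymm : ∀ m n, x n m = x m n := fun m n ↦ by simp only [hx]; ring
  have hterm : ∀ m n : idx N, x m n *
      (if ((m : ℤ)) = (n : ℤ) then (0 : ℝ)
        else (1 / π * Real.sin (2 * π * ω * ((m : ℤ) : ℝ)) -
            1 / π * Real.sin (2 * π * ω * ((n : ℤ) : ℝ))) / (((m : ℤ) : ℝ) - ((n : ℤ) : ℝ))) =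
      P m n - Q m n := by
    intro m n
    simp only [hP, hQ]
    split_ifs with h
    · ring
    · ring
  have hQP : ∑ m : idx N, ∑ n : idx N, Q m n = -∑ m : idx N, ∑ n : idx N, P m n := by
    rw [Finset.sum_comm]
    rw [← Finset.sum_neg_distrib]
    refine Finset.sum_congr rfl fun a _ ↦ ?_
    rw [← Finset.sum_neg_distrib]
    refine Finset.sum_congr rfl fun b _ ↦ ?_
    -- goal: `Q b a = -P a b`
    simp only [hP, hQ]
    by_cases hab : ((a : ℤ)) = (b : ℤ)
    · have hba : ((b : ℤ)) = (a : ℤ) := hab.symm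
      rw [if_pos hba, if_pos hab, neg_zero]
    · have hba : ¬ ((b : ℤ)) = (a : ℤ) := fun h ↦ hab h.symm
      rw [if_neg hba, if_neg hab, hxsymm a b]
      have hne : (((a : ℤ) : ℝ) - ((b : ℤ) : ℝ)) ≠ 0 := by
        rw [sub_ne_zero]; exact_mod_cast hab
      have hne' : (((b : ℤ) : ℝ) - ((a : ℤ) : ℝ)) ≠ 0 := by
        rw [sub_ne_zero]; exact_mod_cast hba
      field_simp
      ring
  calc ∑ m : idx N, ∑ n : idx N, x m n *
        (if ((m : ℤ)) = (n : ℤ) then (0 : ℝ)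
          else (1 / π * Real.sin (2 * π * ω * ((m : ℤ) : ℝ)) -
              1 / π * Real.sin (2 * π * ω * ((n : ℤ) : ℝ))) / (((m : ℤ) : ℝ) - ((n : ℤ) : ℝ)))
      = ∑ m : idx N, ∑ n : idx N, (P m n - Q m n) := by
        refine Finset.sum_congr rfl fun m _ ↦ Finset.sum_congr rfl fun n _ ↦ hterm m n
    _ = ∑ m : idx N, ∑ n : idx N, P m n - ∑ m : idx N, ∑ n : idx N, Q m n := by
        rw [← Finset.sum_sub_distrib]
        refine Finset.sum_congr rfl fun m _ ↦ Finset.sum_sub_distrib _ _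
    _ = 2 * ∑ m : idx N, ∑ n : idx N, P m n := by rw [hQP]; ring
    _ = 2 / π * ∑ m : idx N, (∑ n : idx N, (if ((m : ℤ)) = (n : ℤ) then (0 : ℝ)
          else x m n / (((m : ℤ) : ℝ) - ((n : ℤ) : ℝ)))) * Real.sin (2 * π * ω * ((m : ℤ) : ℝ)) := by
        have hL : 2 * ∑ m : idx N, ∑ n : idx N, P m n = ∑ m : idx N, ∑ n : idx N, 2 * P m n := by
          rw [Finset.mul_sum]
          exact Finset.sum_congr rfl fun m _ ↦ Finset.mul_sum _ _ _
        have hR : 2 / π * ∑ m : idx N, (∑ n : idx N, (if ((m : ℤ)) = (n : ℤ) then (0 : ℝ)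
            else x m n / (((m : ℤ) : ℝ) - ((n : ℤ) : ℝ)))) * Real.sin (2 * π * ω * ((m : ℤ) : ℝ)) =
            ∑ m : idx N, ∑ n : idx N, 2 / π * ((if ((m : ℤ)) = (n : ℤ) then (0 : ℝ)
              else x m n / (((m : ℤ) : ℝ) - ((n : ℤ) : ℝ))) * Real.sin (2 * π * ω * ((m : ℤ) : ℝ))) := by
          rw [Finset.mul_sum]
          refine Finset.sum_congr rfl fun m _ ↦ ?_
          rw [Finset.sum_mul, Finset.mul_sum]
        rw [hL, hR]
        refine Finset.sum_congr rfl fun m _ ↦ Finset.sum_congr rfl fun n _ ↦ ?_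
        simp only [hP]
        split_ifs
        · ring
        · ring

/-! ### Trigonometric uniqueness for odd sine sums -/

/-- `∫₀¹ cos(2πjω) dω = [j = 0]` for an integer `j` (private copy). [folklore] -/
private theorem integral_cos_two_pi_int_mul' (j : ℤ) :
    ∫ ω in (0 : ℝ)..1, Real.cos (2 * π * j * ω) = if j = 0 then 1 else 0 := by
  by_cases hj : j = 0
  · simp [hj]
  · have hc : (2 * π * (j : ℝ)) ≠ 0 := by
      have : (j : ℝ) ≠ 0 := by exact_mod_cast hj
      positivity
    rw [if_neg hj, intervalIntegral.integral_comp_mul_left (fun x ↦ Real.cos x) hc, integral_cos]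
    have h1 : Real.sin (2 * π * (j : ℝ)) = 0 := by
      rw [show 2 * π * (j : ℝ) = ((2 * j : ℤ) : ℝ) * π by push_cast; ring]
      exact Real.sin_int_mul_pi _
    simp [h1]

/-- `∫₀¹ sin(2πmω) sin(2πkω) dω = ½([m = k] − [m = −k])` for integers `m, k`. [folklore] -/
private theorem integral_sin_mul_sin_int (m k : ℤ) :
    ∫ ω in (0 : ℝ)..1, Real.sin (2 * π * m * ω) * Real.sin (2 * π * k * ω) =
      1 / 2 * ((if m = k then 1 else 0) - (if m = -k then 1 else 0)) := by
  have hprod : ∀ ω : ℝ, Real.sin (2 * π * m * ω) * Real.sin (2 * π * k * ω) =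
      1 / 2 * Real.cos (2 * π * ((m - k : ℤ) : ℝ) * ω) -
        1 / 2 * Real.cos (2 * π * ((m + k : ℤ) : ℝ) * ω) := by
    intro ω
    have h1 : 2 * π * ((m - k : ℤ) : ℝ) * ω = 2 * π * m * ω - 2 * π * k * ω := by push_cast; ring
    have h2 : 2 * π * ((m + k : ℤ) : ℝ) * ω = 2 * π * m * ω + 2 * π * k * ω := by push_cast; ring
    rw [h1, h2, Real.cos_sub, Real.cos_add]
    ring
  simp_rw [hprod]
  rw [intervalIntegral.integral_sub (by apply Continuous.intervalIntegrable; fun_prop)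
    (by apply Continuous.intervalIntegrable; fun_prop),
    intervalIntegral.integral_const_mul, intervalIntegral.integral_const_mul,
    integral_cos_two_pi_int_mul', integral_cos_two_pi_int_mul']
  have e1 : (m - k = 0) ↔ (m = k) := sub_eq_zero
  have e2 : (m + k = 0) ↔ (m = -k) := add_eq_zero_iff_eq_neg
  simp only [e1, e2]
  ring

/-- **Uniqueness of odd sine sums**: if `Σ_{m ∈ I_N} c_m sin(2πωm) = 0` for every real `ω` and
`c_{−m} = −c_m`, then `c = 0`. [cite: Groskin2026, Corollary 2.7, proof (p. 8)] -/
theorem eq_zero_of_sum_mul_sin_eq_zero {N : ℕ} (c : idx N → ℝ)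
    (hc : ∀ m, c (negIdx N m) = -c m)
    (h : ∀ ω : ℝ, ∑ m : idx N, c m * Real.sin (2 * π * ω * ((m : ℤ) : ℝ)) = 0) (k : idx N) :
    c k = 0 := by
  have hint : ∫ ω in (0 : ℝ)..1,
      (∑ m : idx N, c m * Real.sin (2 * π * ω * ((m : ℤ) : ℝ))) * Real.sin (2 * π * ((k : ℤ) : ℝ) * ω)
        = 0 := by
    rw [show (fun ω : ℝ ↦ (∑ m : idx N, c m * Real.sin (2 * π * ω * ((m : ℤ) : ℝ))) *
        Real.sin (2 * π * ((k : ℤ) : ℝ) * ω)) = fun _ ↦ 0 from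
      funext fun ω ↦ by rw [h ω, zero_mul]]
    simp
  have hexp : ∫ ω in (0 : ℝ)..1,
      (∑ m : idx N, c m * Real.sin (2 * π * ω * ((m : ℤ) : ℝ))) * Real.sin (2 * π * ((k : ℤ) : ℝ) * ω)
        = ∑ m : idx N, c m * (1 / 2 * ((if ((m : ℤ)) = (k : ℤ) then 1 else 0) -
            (if ((m : ℤ)) = -(k : ℤ) then 1 else 0))) := by
    have hrw : ∀ ω : ℝ, (∑ m : idx N, c m * Real.sin (2 * π * ω * ((m : ℤ) : ℝ))) *
        Real.sin (2 * π * ((k : ℤ) : ℝ) * ω) =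
        ∑ m : idx N, c m * (Real.sin (2 * π * ((m : ℤ) : ℝ) * ω) * Real.sin (2 * π * ((k : ℤ) : ℝ) * ω)) := by
      intro ω
      rw [Finset.sum_mul]
      refine Finset.sum_congr rfl fun m _ ↦ ?_
      rw [show 2 * π * ω * ((m : ℤ) : ℝ) = 2 * π * ((m : ℤ) : ℝ) * ω by ring]
      ring
    simp_rw [hrw]
    rw [intervalIntegral.integral_finsetSum (fun m _ ↦ by
      apply Continuous.intervalIntegrable; fun_prop)]
    refine Finset.sum_congr rfl fun m _ ↦ ?_
    rw [intervalIntegral.integral_const_mul, integral_sin_mul_sin_int]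
  rw [hexp] at hint
  have hk1 : ∀ m : idx N, (((m : ℤ)) = (k : ℤ)) ↔ m = k := fun m ↦ Subtype.ext_iff.symm
  have hk2 : ∀ m : idx N, (((m : ℤ)) = -(k : ℤ)) ↔ m = negIdx N k := by
    intro m
    rw [← coe_negIdx]
    exact Subtype.ext_iff.symm
  simp_rw [hk1, hk2] at hint
  have hsplit : ∑ m : idx N, c m * (1 / 2 * ((if m = k then (1:ℝ) else 0) -
      (if m = negIdx N k then (1:ℝ) else 0))) =
      1 / 2 * ∑ m : idx N, (if m = k then c m else 0) -
        1 / 2 * ∑ m : idx N, (if m = negIdx N k then c m else 0) := by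
    rw [Finset.mul_sum, Finset.mul_sum, ← Finset.sum_sub_distrib]
    refine Finset.sum_congr rfl fun m _ ↦ ?_
    split_ifs <;> ring
  rw [hsplit, Finset.sum_ite_eq' Finset.univ k, Finset.sum_ite_eq' Finset.univ (negIdx N k)] at hint
  simp only [Finset.mem_univ, if_true, hc k] at hint
  linarith

/-- The cross-term coefficients `D_m = Σ_{n≠m} (u_mu_n − u′_mu′_n)/(m − n)` are odd in `m` (the even
embedding is even). [cite: Groskin2026, Corollary 2.7, proof (p. 8)] -/
theorem crossCoeff_negIdx (N : ℕ) (v w : Fin (N + 1) → ℝ) (m : idx N) :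
    (∑ n : idx N, (if (((negIdx N m : idx N) : ℤ)) = (n : ℤ) then (0 : ℝ)
        else (evenEmbed N v (negIdx N m) * evenEmbed N v n -
            evenEmbed N w (negIdx N m) * evenEmbed N w n) /
          ((((negIdx N m : idx N) : ℤ) : ℝ) - ((n : ℤ) : ℝ)))) =
      -∑ n : idx N, (if ((m : ℤ)) = (n : ℤ) then (0 : ℝ)
        else (evenEmbed N v m * evenEmbed N v n - evenEmbed N w m * evenEmbed N w n) /
          (((m : ℤ) : ℝ) - ((n : ℤ) : ℝ))) := by
  rw [← Equiv.sum_comp (negIdx N), ← Finset.sum_neg_distrib]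
  refine Finset.sum_congr rfl fun n _ ↦ ?_
  simp only [coe_negIdx, evenEmbed_negIdx]
  by_cases hmn : ((m : ℤ)) = (n : ℤ)
  · rw [if_pos (by rw [hmn]), if_pos hmn, neg_zero]
  · have hmn' : ¬ (-(m : ℤ) = -(n : ℤ)) := fun h ↦ hmn (neg_injective h)
    rw [if_neg hmn', if_neg hmn]
    have hden : (((-(m : ℤ) : ℤ) : ℝ) - ((-(n : ℤ) : ℤ) : ℝ)) = -((((m : ℤ) : ℝ) - ((n : ℤ) : ℝ))) := by
      push_cast; ring
    rw [hden, div_neg]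

/-- **The cross terms vanish**: `K_v = K_w` on `[0,1]` implies
`Σ_{n≠m} (u_mu_n − u′_mu′_n)/(m − n) = 0` for every `m ∈ I_N`.
[cite: Groskin2026, Corollary 2.7, proof (p. 8)] -/
theorem crossCoeff_eq_zero_of_volterraKernel_eqOn (N : ℕ) (v w : Fin (N + 1) → ℝ)
    (h : Set.EqOn (volterraKernel N v) (volterraKernel N w) (Set.Icc 0 1)) (m : idx N) :
    ∑ n : idx N, (if ((m : ℤ)) = (n : ℤ) then (0 : ℝ)
      else (evenEmbed N v m * evenEmbed N v n - evenEmbed N w m * evenEmbed N w n) /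
        (((m : ℤ) : ℝ) - ((n : ℤ) : ℝ))) = 0 := by
  have hall := volterraKernel_eq_of_eqOn N v w h
  have hsq := sq_evenEmbed_eq_of_volterraKernel_eqOn N v w h
  have hsin : ∀ ω : ℝ, ∑ m : idx N, (∑ n : idx N, (if ((m : ℤ)) = (n : ℤ) then (0 : ℝ)
      else (evenEmbed N v m * evenEmbed N v n - evenEmbed N w m * evenEmbed N w n) /
        (((m : ℤ) : ℝ) - ((n : ℤ) : ℝ)))) * Real.sin (2 * π * ω * ((m : ℤ) : ℝ)) = 0 := by
    intro ω
    have h1 := sum_cross_mul_offDiag_eq_zero N v w hall hsq ω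
    rw [sum_cross_eq_sin_sum] at h1
    have hπ : (2 / π : ℝ) ≠ 0 := by positivity
    exact (mul_eq_zero.1 h1).resolve_left hπ
  exact eq_zero_of_sum_mul_sin_eq_zero _ (crossCoeff_negIdx N v w) hsin m

/-! ### The partial-fraction step: `u_m² = u′_m²` and vanishing cross terms force `u′ = ±u` -/

/-- The nodes `m ∈ I_N` satisfy `|m| ≤ N`. [cite: Groskin2026, §2.1 (p. 3)] -/
private theorem abs_node_le {N : ℕ} (m : idx N) : |((m : ℤ) : ℝ)| ≤ N := by
  have h := m.2
  simp only [idx, Finset.mem_Icc] at h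
  rw [abs_le]
  exact ⟨by exact_mod_cast h.1, by exact_mod_cast h.2⟩

/-- **The square of a partial fraction**, pointwise: for `s` off the nodes,
`(Σ_m a_m/(s − m))(Σ_m b_m/(s − m)) = Σ_m a_mb_m/(s − m)² + Σ_m (Σ_{n≠m} (a_mb_n + a_nb_m)/(m − n))/(s − m)`
— here specialised to `a = u − u′`, `b = u + u′` with `a_mb_m = u_m² − u′_m² = 0` and
`a_mb_n + a_nb_m = 2(u_mu_n − u′_mu′_n)`, whose cross sums vanish: the product is `0`.
[cite: Groskin2026, Corollary 2.7, proof (p. 8): "`(T_v − T_w) ∗ (T_v + T_w) = 0`"] -/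
theorem sum_div_mul_sum_div_eq_zero (N : ℕ) (v w : Fin (N + 1) → ℝ)
    (hsq : ∀ m : idx N, evenEmbed N v m ^ 2 = evenEmbed N w m ^ 2)
    (hD : ∀ m : idx N, ∑ n : idx N, (if ((m : ℤ)) = (n : ℤ) then (0 : ℝ)
      else (evenEmbed N v m * evenEmbed N v n - evenEmbed N w m * evenEmbed N w n) /
        (((m : ℤ) : ℝ) - ((n : ℤ) : ℝ))) = 0)
    {s : ℝ} (hs : ∀ m : idx N, s ≠ ((m : ℤ) : ℝ)) :
    (∑ m : idx N, (evenEmbed N v m - evenEmbed N w m) / (s - ((m : ℤ) : ℝ))) *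
      (∑ m : idx N, (evenEmbed N v m + evenEmbed N w m) / (s - ((m : ℤ) : ℝ))) = 0 := by
  set u := evenEmbed N v with hu
  set u' := evenEmbed N w with hu'
  have hsm : ∀ m : idx N, s - ((m : ℤ) : ℝ) ≠ 0 := fun m ↦ sub_ne_zero.2 (hs m)
  -- the two halves of the off-diagonal term after partial fractions
  set P : idx N → idx N → ℝ := fun m n ↦ if ((m : ℤ)) = (n : ℤ) then (0 : ℝ)
    else (u m - u' m) * (u n + u' n) / ((((m : ℤ) : ℝ) - ((n : ℤ) : ℝ)) * (s - ((m : ℤ) : ℝ)))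
    with hP
  set Q : idx N → idx N → ℝ := fun m n ↦ if ((m : ℤ)) = (n : ℤ) then (0 : ℝ)
    else (u m - u' m) * (u n + u' n) / ((((m : ℤ) : ℝ) - ((n : ℤ) : ℝ)) * (s - ((n : ℤ) : ℝ)))
    with hQ
  have hterm : ∀ m n : idx N,
      (u m - u' m) / (s - ((m : ℤ) : ℝ)) * ((u n + u' n) / (s - ((n : ℤ) : ℝ))) = P m n - Q m n := by
    intro m n
    by_cases hmn : ((m : ℤ)) = (n : ℤ)
    · have hmn' : m = n := Subtype.ext hmn
      subst hmn'
      have hPmm : P m m = 0 := by simp only [hP]; simp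
      have hQmm : Q m m = 0 := by simp only [hQ]; simp
      rw [hPmm, hQmm, sub_zero]
      have h0 : (u m - u' m) * (u m + u' m) = 0 := by
        have := hsq m
        nlinarith [this]
      rw [div_mul_div_comm, h0, zero_div]
    · have hPmn : P m n =
          (u m - u' m) * (u n + u' n) / ((((m : ℤ) : ℝ) - ((n : ℤ) : ℝ)) * (s - ((m : ℤ) : ℝ))) := by
        simp only [hP]; rw [if_neg hmn]
      have hQmn : Q m n =
          (u m - u' m) * (u n + u' n) / ((((m : ℤ) : ℝ) - ((n : ℤ) : ℝ)) * (s - ((n : ℤ) : ℝ))) := by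
        simp only [hQ]; rw [if_neg hmn]
      rw [hPmn, hQmn]
      have hne : (((m : ℤ) : ℝ) - ((n : ℤ) : ℝ)) ≠ 0 := by
        rw [sub_ne_zero]; exact_mod_cast hmn
      have h1 := hsm m
      have h2 := hsm n
      field_simp
      ring
  have hQP : ∑ m : idx N, ∑ n : idx N, Q m n = -∑ m : idx N, ∑ n : idx N,
      (if ((m : ℤ)) = (n : ℤ) then (0 : ℝ)
        else (u n - u' n) * (u m + u' m) / ((((m : ℤ) : ℝ) - ((n : ℤ) : ℝ)) * (s - ((m : ℤ) : ℝ)))) := by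
    rw [Finset.sum_comm, ← Finset.sum_neg_distrib]
    refine Finset.sum_congr rfl fun a _ ↦ ?_
    rw [← Finset.sum_neg_distrib]
    refine Finset.sum_congr rfl fun b _ ↦ ?_
    simp only [hQ]
    by_cases hab : ((a : ℤ)) = (b : ℤ)
    · rw [if_pos hab.symm, if_pos hab, neg_zero]
    · have hba : ¬ ((b : ℤ)) = (a : ℤ) := fun h ↦ hab h.symm
      rw [if_neg hba, if_neg hab]
      have hne : (((a : ℤ) : ℝ) - ((b : ℤ) : ℝ)) ≠ 0 := by
        rw [sub_ne_zero]; exact_mod_cast hab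
      have hne' : (((b : ℤ) : ℝ) - ((a : ℤ) : ℝ)) ≠ 0 := by
        rw [sub_ne_zero]; exact_mod_cast hba
      have h1 := hsm a
      field_simp
      ring
  rw [Finset.sum_mul_sum]
  calc ∑ m : idx N, ∑ n : idx N,
        (u m - u' m) / (s - ((m : ℤ) : ℝ)) * ((u n + u' n) / (s - ((n : ℤ) : ℝ)))
      = ∑ m : idx N, ∑ n : idx N, (P m n - Q m n) :=
        Finset.sum_congr rfl fun m _ ↦ Finset.sum_congr rfl fun n _ ↦ hterm m n
    _ = ∑ m : idx N, ∑ n : idx N, P m n - ∑ m : idx N, ∑ n : idx N, Q m n := by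
        rw [← Finset.sum_sub_distrib]
        exact Finset.sum_congr rfl fun m _ ↦ Finset.sum_sub_distrib _ _
    _ = ∑ m : idx N, ∑ n : idx N, (P m n + (if ((m : ℤ)) = (n : ℤ) then (0 : ℝ)
        else (u n - u' n) * (u m + u' m) / ((((m : ℤ) : ℝ) - ((n : ℤ) : ℝ)) * (s - ((m : ℤ) : ℝ))))) := by
        rw [hQP, sub_neg_eq_add, ← Finset.sum_add_distrib]
        exact Finset.sum_congr rfl fun m _ ↦ (Finset.sum_add_distrib).symm
    _ = ∑ m : idx N, (2 / (s - ((m : ℤ) : ℝ))) * ∑ n : idx N, (if ((m : ℤ)) = (n : ℤ) then (0 : ℝ)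
        else (u m * u n - u' m * u' n) / (((m : ℤ) : ℝ) - ((n : ℤ) : ℝ))) := by
        refine Finset.sum_congr rfl fun m _ ↦ ?_
        rw [Finset.mul_sum]
        refine Finset.sum_congr rfl fun n _ ↦ ?_
        by_cases hmn : ((m : ℤ)) = (n : ℤ)
        · have hmn' : m = n := Subtype.ext hmn
          subst hmn'
          simp [hP]
        · have hPmn : P m n =
              (u m - u' m) * (u n + u' n) / ((((m : ℤ) : ℝ) - ((n : ℤ) : ℝ)) * (s - ((m : ℤ) : ℝ))) := by
            simp only [hP]; rw [if_neg hmn]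
          rw [hPmn, if_neg hmn, if_neg hmn]
          have hne : (((m : ℤ) : ℝ) - ((n : ℤ) : ℝ)) ≠ 0 := by
            rw [sub_ne_zero]; exact_mod_cast hmn
          have h1 := hsm m
          field_simp
          ring
    _ = 0 := by
        refine Finset.sum_eq_zero fun m _ ↦ ?_
        have := hD m
        simp only [hu, hu'] at this ⊢
        rw [this, mul_zero]

/-- **Vanishing partial fraction ⇒ vanishing coefficients** (Lagrange evaluation at the nodes): if the
polynomial `Σ_m c_m Π_{n≠m} (X − n)` is zero then `c = 0`. [folklore] -/
private theorem coeff_eq_zero_of_lagrange_eq_zero {N : ℕ} (c : idx N → ℝ)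
    (h : ∑ m : idx N, Polynomial.C (c m) *
      ∏ n ∈ Finset.univ.erase m, (Polynomial.X - Polynomial.C (((n : ℤ) : ℝ))) = 0) (k : idx N) :
    c k = 0 := by
  have hev := congr_arg (Polynomial.eval (((k : ℤ) : ℝ))) h
  rw [Polynomial.eval_finsetSum, Polynomial.eval_zero] at hev
  simp only [Polynomial.eval_mul, Polynomial.eval_C, Polynomial.eval_prod, Polynomial.eval_sub,
    Polynomial.eval_X] at hev
  rw [Finset.sum_eq_single k] at hev
  · have hprod : ∏ n ∈ Finset.univ.erase k, ((((k : ℤ) : ℝ)) - ((n : ℤ) : ℝ)) ≠ 0 := by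
      rw [Finset.prod_ne_zero_iff]
      intro n hn
      have hne : n ≠ k := (Finset.mem_erase.1 hn).1
      rw [sub_ne_zero]
      have : ((k : ℤ)) ≠ (n : ℤ) := fun h ↦ hne (Subtype.ext h).symm
      exact_mod_cast this
    exact (mul_eq_zero.1 hev).resolve_right hprod
  · intro m _ hmk
    apply mul_eq_zero_of_right
    apply Finset.prod_eq_zero (i := k) (Finset.mem_erase.2 ⟨fun h ↦ hmk h.symm, Finset.mem_univ _⟩)
    exact sub_self _
  · intro hk; exact absurd (Finset.mem_univ k) hk

/-- **The partial-fraction step**: `u_m² = u′_m²` for all `m` and vanishing cross sums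
`Σ_{n≠m}(u_mu_n − u′_mu′_n)/(m − n) = 0` force `u = u′` or `u = −u′` (the product of the polynomials
`Σ_m (u_m ∓ u′_m) Π_{n≠m}(X − n)` vanishes at every real `s > N`, so one of them is the zero polynomial).
[cite: Groskin2026, Corollary 2.7, proof (p. 8): "`T_v = ±T_w`"] -/
theorem evenEmbed_eq_or_eq_neg (N : ℕ) (v w : Fin (N + 1) → ℝ)
    (hsq : ∀ m : idx N, evenEmbed N v m ^ 2 = evenEmbed N w m ^ 2)
    (hD : ∀ m : idx N, ∑ n : idx N, (if ((m : ℤ)) = (n : ℤ) then (0 : ℝ)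
      else (evenEmbed N v m * evenEmbed N v n - evenEmbed N w m * evenEmbed N w n) /
        (((m : ℤ) : ℝ) - ((n : ℤ) : ℝ))) = 0) :
    evenEmbed N v = evenEmbed N w ∨ evenEmbed N v = -evenEmbed N w := by
  set u := evenEmbed N v with hu
  set u' := evenEmbed N w with hu'
  -- the two Lagrange-type polynomials
  set p : Polynomial ℝ := ∑ m : idx N, Polynomial.C (u m - u' m) *
    ∏ n ∈ Finset.univ.erase m, (Polynomial.X - Polynomial.C (((n : ℤ) : ℝ))) with hp
  set q : Polynomial ℝ := ∑ m : idx N, Polynomial.C (u m + u' m) *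
    ∏ n ∈ Finset.univ.erase m, (Polynomial.X - Polynomial.C (((n : ℤ) : ℝ))) with hq
  -- evaluation off the nodes
  have heval : ∀ (c : idx N → ℝ) (s : ℝ), (∀ m : idx N, s ≠ ((m : ℤ) : ℝ)) →
      Polynomial.eval s (∑ m : idx N, Polynomial.C (c m) *
        ∏ n ∈ Finset.univ.erase m, (Polynomial.X - Polynomial.C (((n : ℤ) : ℝ)))) =
      (∏ n : idx N, (s - ((n : ℤ) : ℝ))) * ∑ m : idx N, c m / (s - ((m : ℤ) : ℝ)) := by
    intro c s hs
    rw [Polynomial.eval_finsetSum, Finset.mul_sum]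
    refine Finset.sum_congr rfl fun m _ ↦ ?_
    simp only [Polynomial.eval_mul, Polynomial.eval_C, Polynomial.eval_prod, Polynomial.eval_sub,
      Polynomial.eval_X]
    have hsm : s - ((m : ℤ) : ℝ) ≠ 0 := sub_ne_zero.2 (hs m)
    have hfull := Finset.mul_prod_erase Finset.univ (fun n : idx N ↦ s - ((n : ℤ) : ℝ))
      (Finset.mem_univ m)
    rw [← hfull]
    field_simp
  have hroot : ∀ s : ℝ, (N : ℝ) < s → Polynomial.IsRoot (p * q) s := by
    intro s hsN
    have hs : ∀ m : idx N, s ≠ ((m : ℤ) : ℝ) := by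
      intro m h
      have := (abs_le.1 (abs_node_le m)).2
      linarith
    rw [Polynomial.IsRoot.def, Polynomial.eval_mul, hp, hq, heval _ s hs, heval _ s hs]
    have h0 := sum_div_mul_sum_div_eq_zero N v w hsq hD hs
    simp only [hu, hu'] at h0 ⊢
    calc _ = (∏ n : idx N, (s - ((n : ℤ) : ℝ))) ^ 2 *
          ((∑ m : idx N, (evenEmbed N v m - evenEmbed N w m) / (s - ((m : ℤ) : ℝ))) *
            (∑ m : idx N, (evenEmbed N v m + evenEmbed N w m) / (s - ((m : ℤ) : ℝ)))) := by ring
      _ = 0 := by rw [h0, mul_zero]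
  have hpq : p * q = 0 := by
    apply Polynomial.eq_zero_of_infinite_isRoot
    exact Set.Infinite.mono (fun s hs ↦ hroot s hs) (Set.Ioi_infinite (N : ℝ))
  rcases mul_eq_zero.1 hpq with h0 | h0
  · left
    funext k
    have := coeff_eq_zero_of_lagrange_eq_zero (fun m ↦ u m - u' m) h0 k
    simp only [hu, hu'] at this
    linarith
  · right
    funext k
    have := coeff_eq_zero_of_lagrange_eq_zero (fun m ↦ u m + u' m) h0 k
    simp only [hu, hu'] at this
    rw [Pi.neg_apply]
    linarith

/-! ### From the even embedding back to `v` -/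

/-- The even embedding is injective. [cite: Groskin2026, §2.1 (p. 3): "isometric even-sector embedding"] -/
theorem evenEmbed_injective (N : ℕ) : Function.Injective (evenEmbed N) := by
  intro v w h
  funext i
  obtain rfl | ⟨k, rfl⟩ := i.eq_zero_or_eq_succ
  · rw [← evenEmbed_zero' N v, ← evenEmbed_zero' N w, h]
  · have hv := evenEmbed_succ' v k
    have hw := evenEmbed_succ' w k
    rw [h] at hv
    rw [hv] at hw
    have hs : Real.sqrt 2 ≠ 0 := by positivity
    field_simp at hw
    linarith

/-- The even embedding is odd under `v ↦ −v`: `u(−v) = −u(v)`. [cite: Groskin2026, §2.1 (p. 3)] -/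
theorem evenEmbed_neg (N : ℕ) (v : Fin (N + 1) → ℝ) : evenEmbed N (-v) = -evenEmbed N v := by
  funext m
  simp only [evenEmbed, Pi.neg_apply]
  split_ifs <;> ring

/-- **The Volterra integral-domain lemma**: `K_v = K_w` on `[0,1]` implies `v = w ∨ v = −w`.
[cite: Groskin2026, Corollary 2.7, proof (p. 8): "`T_v = ±T_w` and `v = ±w`"] -/
theorem eq_or_eq_neg_of_volterraKernel_eqOn (N : ℕ) (v w : Fin (N + 1) → ℝ)
    (h : Set.EqOn (volterraKernel N v) (volterraKernel N w) (Set.Icc 0 1)) : v = w ∨ v = -w := by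
  have hsq := sq_evenEmbed_eq_of_volterraKernel_eqOn N v w h
  have hD := crossCoeff_eq_zero_of_volterraKernel_eqOn N v w h
  rcases evenEmbed_eq_or_eq_neg N v w hsq hD with hu | hu
  · exact Or.inl (evenEmbed_injective N hu)
  · right
    rw [← evenEmbed_neg] at hu
    exact evenEmbed_injective N hu

/-! ### Assembly -/

/-- **[Gr26] Corollary 2.7 (pole-neutral source survival)**, discharging the claim `corollary_2_7`:
for `c > 1` and `N ≥ s + 2`, `dim(H_s(N) ∩ P_N(c)) = N − s − 1`; every nonzero `v` in that family has
`g_v ≠ 0` and `g_v(i/2) = 0`; and `g_v = g_w` implies `v = ±w`. PROVED as printed: the dimension count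
(frontier-1's `corollary_2_7_dim`), the pole-square identity (`g_v(i/2) = 0`), Fourier injectivity
(`corollary_2_7_of_volterra`), and the Volterra integral-domain step rendered through the partial
fractions `Σ_m u_m/(s − m)` (`eq_or_eq_neg_of_volterraKernel_eqOn`).
[cite: Groskin2026, Corollary 2.7 (p. 7–8)] -/
theorem corollary_2_7_holds : Groskin2026.corollary_2_7 :=
  corollary_2_7_of_volterra eq_or_eq_neg_of_volterraKernel_eqOn

end Groskin2026

end Literature.NumberTheory.LFunctions

end
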